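import Summits.Ventures.PercRepro.Minor
import Summits.Ventures.PercRepro.CubeSum

/-!
# PercRepro — the antipodal principle for C-011 on minors, and C-011 / C-005 «on ≤ N vertices» (typer-2, gen 4)

p1's `P1-census-g3.md` §A: «every minor of a multigraph on ≤ 8 vertices is a multigraph on ≤ 8
vertices, so by the antipodal principle C-011 and C-005 hold for every multigraph on ≤ 8 vertices,
every marking, every `p`» — modulo the class-level computation. The Lean shape:

* `faceSumC011 G m u v` — the class sum of the C-011 kernel on the class `(join u, meet v)`;
  **`faceSumC011_eq_minor`** — it is the full-cube class sum `cubeSumC011` of the marked minor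
  `G.minor u v` (`Minor.lean`); **`phiPlus_eq_sum_faceSumC011`** — `Φ⁺` is the weighted sum of the
  class sums; **`phiPlus_nonneg_of_minors`** — `Φ⁺(G, p) ≥ 0` whenever every minor of `G` has a
  nonnegative class sum (one graph, every `p`);
* `cubeSumC011_nonneg_iff` — `CS ≥ 0 ↔ b + n ≤ g` (Lemma B⁺ on the full cube);
* **`LemmaBPlusUpTo N`** (Lemma B⁺ on the full cube of every marked multigraph with ≤ N vertices —
  the finite computation), **`C011UpTo N`**, **`C005UpTo N`** (the two row inequalities on every
  multigraph with ≤ N vertices, every `p`, every marking) and **`C011UpTo_of_LemmaBPlusUpTo`**,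
  **`C005UpTo_of_LemmaBPlusUpTo`** (the quotient minor has at most as many vertices:
  `Fintype.card_quotient_le`). With p1's kernel-checkable computation for `N = 8` this is the
  «theorem on ≤ 8 vertices» of CHECKPOINT v0.9 §2.
-/

namespace PercRepro

open Finset

namespace MultiGraph

variable {V E : Type*} (G : MultiGraph V E) [Fintype E] [DecidableEq E]

/-- The class sum of the C-011 kernel on the class `(join u, meet v)`: Lemma B⁺'s `g − b − n` of
the face map `ρ ↦ row4 (Π(embed u v ρ))`. -/
noncomputable def faceSumC011 (m : Fin 4 → V) (u v : Config E) : ℝ :=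
  ∑ ρ : Config (Face u v), phiPlusKernel (row4 (G.markedPartition (embed u v ρ) m))
    (row4 (G.markedPartition (embed u v ρᶜ) m))

/-- **The antipodal principle for C-011**: the class sum of a class is the full-cube class sum of
its marked minor, with the marks replaced by their sure clusters. -/
theorem faceSumC011_eq_minor (m : Fin 4 → V) (u v : Config E) :
    G.faceSumC011 m u v = (G.minor u v).cubeSumC011 fun i => G.sureClass v (m i) := by
  unfold faceSumC011 cubeSumC011 cubeSum
  refine Finset.sum_congr rfl fun ρ _ => ?_
  rw [G.markedPartition_embed, G.markedPartition_embed]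

open Classical in
/-- **`Φ⁺` as the weighted sum of the class sums** of the C-011 kernel. -/
theorem phiPlus_eq_sum_faceSumC011 (p : E → ℝ) (a b c d : V) :
    G.PhiPlus p a b c d = ∑ uv : Config E × Config E, weight p uv.2 * weight p uv.1 *
      if uv.2 ≤ uv.1 then G.faceSumC011 ![a, b, c, d] uv.1 uv.2 else 0 := by
  rw [G.phiPlus_eq_twoCopy, twoCopy_eq_sum_faces p
    (fun ω => row4 (G.markedPartition ω ![a, b, c, d])) phiPlusKernel]
  rfl

/-- **C-011 for one graph from its minors**: `Φ⁺(G, p) ≥ 0` at every `p` whenever every marked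
minor of `G` has a nonnegative full-cube class sum. -/
theorem phiPlus_nonneg_of_minors {p : E → ℝ} (hp : IsProb p) (a b c d : V)
    (h : ∀ u v : Config E, v ≤ u →
      0 ≤ (G.minor u v).cubeSumC011 fun i => G.sureClass v (![a, b, c, d] i)) :
    0 ≤ G.PhiPlus p a b c d := by
  rw [G.phiPlus_eq_sum_faceSumC011]
  refine Finset.sum_nonneg fun uv _ => ?_
  refine mul_nonneg (mul_nonneg (weight_nonneg hp _) (weight_nonneg hp _)) ?_
  split_ifs with hle
  · rw [G.faceSumC011_eq_minor]
    exact h uv.1 uv.2 hle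
  · exact le_rfl

/-- `CS ≥ 0` is Lemma B⁺ on the full cube: `b + n_xR ≤ g`. -/
theorem cubeSumC011_nonneg_iff (m : Fin 4 → V) :
    0 ≤ G.cubeSumC011 m ↔
      badCount (fun ρ : Config E => row4 (G.markedPartition ρ m)) +
        liabilityCount (fun ρ : Config E => row4 (G.markedPartition ρ m)) ≤
      goodCount fun ρ : Config E => row4 (G.markedPartition ρ m) := by
  rw [G.cubeSumC011_eq]
  constructor
  · intro h
    have : ((badCount (fun ρ : Config E => row4 (G.markedPartition ρ m)) +
        liabilityCount (fun ρ : Config E => row4 (G.markedPartition ρ m)) : ℕ) : ℝ) ≤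
        (goodCount fun ρ : Config E => row4 (G.markedPartition ρ m) : ℝ) := by
      push_cast
      linarith
    exact_mod_cast this
  · intro h
    have : ((badCount (fun ρ : Config E => row4 (G.markedPartition ρ m)) +
        liabilityCount (fun ρ : Config E => row4 (G.markedPartition ρ m)) : ℕ) : ℝ) ≤
        (goodCount fun ρ : Config E => row4 (G.markedPartition ρ m) : ℝ) := by
      exact_mod_cast h
    push_cast at this
    linarith

/-- The C-011 row inequality of one graph from `Φ⁺ ≥ 0`. -/
theorem c011_row_of_phiPlus_nonneg {p : E → ℝ} {a b c d : V} (h : 0 ≤ G.PhiPlus p a b c d) :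
    G.law4 p a b c d 3 * G.law4 p a b c d 6 + G.law4 p a b c d 3 * G.law4 p a b c d 8 +
        G.law4 p a b c d 6 * G.law4 p a b c d 8 + G.liabilitySum p a b c d ≤
      G.law4 p a b c d 0 * G.law4 p a b c d 14 := by
  unfold PhiPlus at h
  linarith

/-- The C-005 row inequality of one graph from `Φ⁺ ≥ 0`. -/
theorem c005_row_of_phiPlus_nonneg {p : E → ℝ} (hp : IsProb p) {a b c d : V}
    (h : 0 ≤ G.PhiPlus p a b c d) :
    prob p (G.partitionEvent ![a, b, c, d] ![0, 0, 1, 1]) *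
          prob p (G.partitionEvent ![a, b, c, d] ![0, 1, 0, 1]) +
        prob p (G.partitionEvent ![a, b, c, d] ![0, 0, 1, 1]) *
          prob p (G.partitionEvent ![a, b, c, d] ![0, 1, 1, 0]) +
        prob p (G.partitionEvent ![a, b, c, d] ![0, 1, 0, 1]) *
          prob p (G.partitionEvent ![a, b, c, d] ![0, 1, 1, 0]) ≤
      prob p (G.partitionEvent ![a, b, c, d] ![0, 0, 0, 0]) *
        prob p (G.partitionEvent ![a, b, c, d] ![0, 1, 2, 3]) := by
  have key := G.c011_row_of_phiPlus_nonneg h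
  have hl := G.liabilitySum_nonneg hp a b c d
  obtain ⟨h0, h14, h3, h6, h8⟩ := G.law4_C005_rows p a b c d
  rw [h0, h14, h3, h6, h8] at key
  linarith

end MultiGraph

/-! ### «On at most `N` vertices» -/

/-- **Lemma B⁺ on the full cube of every marked multigraph with at most `N` vertices** — the finite
class-level computation (p1: `N = 8`, 36,540 + 864,220 markings, 0 violations). -/
def LemmaBPlusUpTo (N : ℕ) : Prop :=
  ∀ {V E : Type} [Fintype V] [Fintype E] [DecidableEq E], Fintype.card V ≤ N →
    ∀ (G : MultiGraph V E) (m : Fin 4 → V), 0 ≤ G.cubeSumC011 m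

/-- **C-011 on every multigraph with at most `N` vertices**, every `p`, every marking. -/
def C011UpTo (N : ℕ) : Prop :=
  ∀ {V E : Type} [Fintype V] [Fintype E] [DecidableEq E], Fintype.card V ≤ N →
    ∀ (G : MultiGraph V E) (p : E → ℝ), IsProb p → ∀ a b c d : V,
      G.law4 p a b c d 3 * G.law4 p a b c d 6 + G.law4 p a b c d 3 * G.law4 p a b c d 8 +
          G.law4 p a b c d 6 * G.law4 p a b c d 8 + G.liabilitySum p a b c d ≤
        G.law4 p a b c d 0 * G.law4 p a b c d 14

/-- **C-005 on every multigraph with at most `N` vertices**, every `p`, every marking. -/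
def C005UpTo (N : ℕ) : Prop :=
  ∀ {V E : Type} [Fintype V] [Fintype E] [DecidableEq E], Fintype.card V ≤ N →
    ∀ (G : MultiGraph V E) (p : E → ℝ), IsProb p → ∀ a b c d : V,
      prob p (G.partitionEvent ![a, b, c, d] ![0, 0, 1, 1]) *
            prob p (G.partitionEvent ![a, b, c, d] ![0, 1, 0, 1]) +
          prob p (G.partitionEvent ![a, b, c, d] ![0, 0, 1, 1]) *
            prob p (G.partitionEvent ![a, b, c, d] ![0, 1, 1, 0]) +
          prob p (G.partitionEvent ![a, b, c, d] ![0, 1, 0, 1]) *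
            prob p (G.partitionEvent ![a, b, c, d] ![0, 1, 1, 0]) ≤
        prob p (G.partitionEvent ![a, b, c, d] ![0, 0, 0, 0]) *
          prob p (G.partitionEvent ![a, b, c, d] ![0, 1, 2, 3])

/-- `Φ⁺ ≥ 0` on every multigraph with at most `N` vertices from Lemma B⁺ on at most `N` vertices:
every marked minor lives on the quotient `V / Conn v`, which has at most `|V|` vertices. -/
theorem phiPlus_nonneg_of_lemmaBPlusUpTo {N : ℕ} (h : LemmaBPlusUpTo N) {V E : Type} [Fintype V]
    [Fintype E] [DecidableEq E] (hV : Fintype.card V ≤ N) (G : MultiGraph V E) {p : E → ℝ}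
    (hp : IsProb p) (a b c d : V) : 0 ≤ G.PhiPlus p a b c d := by
  refine G.phiPlus_nonneg_of_minors hp a b c d fun u v _ => ?_
  classical
  exact h ((Fintype.card_quotient_le (G.connSetoid v)).trans hV) (G.minor u v) _

/-- **C-011 on ≤ N vertices from Lemma B⁺ on ≤ N vertices.** -/
theorem C011UpTo_of_LemmaBPlusUpTo {N : ℕ} (h : LemmaBPlusUpTo N) : C011UpTo N :=
  fun {_ _} _ _ _ hV G _ hp a b c d =>
    G.c011_row_of_phiPlus_nonneg (phiPlus_nonneg_of_lemmaBPlusUpTo h hV G hp a b c d)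

/-- **C-005 on ≤ N vertices from Lemma B⁺ on ≤ N vertices.** -/
theorem C005UpTo_of_LemmaBPlusUpTo {N : ℕ} (h : LemmaBPlusUpTo N) : C005UpTo N :=
  fun {_ _} _ _ _ hV G _ hp a b c d =>
    G.c005_row_of_phiPlus_nonneg hp (phiPlus_nonneg_of_lemmaBPlusUpTo h hV G hp a b c d)

end PercRepro
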